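import Literature.Topology.FourManifolds.ClosedBallSmoothMaps
import Mathlib.Geometry.Manifold.VectorField.Pullback
import HarnessLib

/-!
# Tangent vectors of the closed ball `𝔻ⁿ⁺¹` read in the ambient space `ℝⁿ⁺¹`

Fourth file on the closed unit ball `𝔻ⁿ⁺¹ ⊆ ℝⁿ⁺¹` with its manifold-with-boundary structure
(`ClosedBall.lean`: interior chart the translation `x ↦ x + 2e₀`, boundary chart at `p` the
restriction of the ambient *polar chart* `polarChart p : w ↦ (1 - ‖w‖, σ_{-p}(w/‖w‖))` of
`ClosedBallProofs.lean`; `ClosedBallSmoothMaps.lean`: the inclusion `𝔻ⁿ⁺¹ ↪ ℝⁿ⁺¹` is `C^∞`).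
Mathlib reads a tangent vector `v ∈ T_x𝔻ⁿ⁺¹ = ℝⁿ⁺¹` *in the preferred chart at `x`*; this file
provides the dictionary with the ambient picture, in which a tangent vector at `x` is simply a
vector of `ℝⁿ⁺¹` (the image of `v` under the differential of the inclusion):

* `closedBallAmbChart x` — the ambient partial diffeomorphism of `ℝⁿ⁺¹` extending the preferred
  chart at `x` (the translation, resp. the polar chart at `x`): `extChartAt x y = ambChart x y`
  for all `y` and `(extChartAt x)⁻¹ = (ambChart x)⁻¹` on the chart target;
* `closedBallCoeDeriv x : ℝⁿ⁺¹ ≃L[ℝ] ℝⁿ⁺¹` — **the differential at `x` of the inclusion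
  `𝔻ⁿ⁺¹ ↪ ℝⁿ⁺¹`** as a linear isomorphism from `T_x𝔻ⁿ⁺¹` (chart coordinates) onto `ℝⁿ⁺¹`:
  `mfderiv (𝓡∂ (n+1)) 𝓘(ℝ, ℝⁿ⁺¹) Subtype.val x = closedBallCoeDeriv x`
  (`mfderiv_coe_closedBall`); it is the derivative of `(ambChart x)⁻¹` at the chart point;
* `contMDiffAt_tangentSection_iff_closedBall` — **a vector field `X` on `𝔻ⁿ⁺¹` is `C^∞` (as a
  section of the tangent bundle) iff its ambient representative `x ↦ closedBallCoeDeriv x (X x)`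
  is `C^∞` as a map `𝔻ⁿ⁺¹ → ℝⁿ⁺¹`** (pointwise at `x₀`, and globally): in the trivialisation of
  `T𝔻ⁿ⁺¹` at `x₀` the section reads `x ↦ D(ambChart x₀)(x) (coeDeriv x (X x))`
  (`trivializationAt_tangentSpace_closedBall_snd`), and `x ↦ D(ambChart x₀)(x)` is a `C^∞`
  family of invertible matrices near `x₀`;
* `mpullback_coe_closedBall` — Mathlib's pull-back of an ambient vector field `V` along the
  inclusion is `x ↦ (coeDeriv x)⁻¹ (V x)`.

These are the elementary facts behind "vector fields on a regular domain `D ⊆ ℝᵏ` are the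
restrictions of vector fields of `ℝᵏ` along `D`" (Lee, *Introduction to Smooth Manifolds*
(2013), Ch. 3, tangent space of an open/regular domain, and Ch. 8, restriction of vector fields;
Hirsch (1976), §1.4).  Consumer: the standard Stein structure on the 4-ball
(`Literature/Geometry/Symplectic/SteinBall.lean`), whose almost complex structure, Nijenhuis
tensor and Levi form are computed in the ambient `ℂ² = ℝ⁴`.

## References

* J. M. Lee, *Introduction to Smooth Manifolds*, 2nd ed., GTM 218 (2013), Ch. 3 (Prop. 3.9,
  tangent space to an open submanifold; manifolds with boundary), Ch. 5 (regular domains),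
  Ch. 8 (vector fields along submanifolds).
* M. W. Hirsch, *Differential Topology*, GTM 33 (1976), §1.4.
-/

open scoped Manifold ContDiff Topology
open Set Function Metric

noncomputable section

namespace Literature.Topology.FourManifolds

/-- Local notation: `𝔼 n` is the model Euclidean space `EuclideanSpace ℝ (Fin n)`. -/
local notation "𝔼 " n:arg => EuclideanSpace ℝ (Fin n)

/-- Local notation: `𝕊 n` is the unit sphere in `EuclideanSpace ℝ (Fin (n + 1))`. -/
local notation "𝕊 " n:arg => (Metric.sphere (0 : EuclideanSpace ℝ (Fin (n + 1))) 1)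

/-- Local notation: `𝔻 n` is the closed unit ball in `EuclideanSpace ℝ (Fin n)`. -/
local notation "𝔻 " n:arg => (Metric.closedBall (0 : EuclideanSpace ℝ (Fin n)) 1)

attribute [local instance] fact_finrank_euclideanSpace_succ

variable {n : ℕ}

/-! ### The ambient chart at a point -/

/-- A point of the closed ball which is not in the open ball lies on the unit sphere. [folklore] -/
theorem norm_coe_eq_one_of_not_lt {x : 𝔻 (n + 1)} (h : ¬ ‖(x : 𝔼 (n + 1))‖ < 1) :
    ‖(x : 𝔼 (n + 1))‖ = 1 :=
  (mem_closedBall_zero_iff.1 x.2).antisymm (not_lt.1 h)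

/-- **The ambient chart at `x ∈ 𝔻ⁿ⁺¹`**: the partial diffeomorphism of `ℝⁿ⁺¹` extending the
preferred chart of `𝔻ⁿ⁺¹` at `x` — the translation `w ↦ w + 2e₀` if `‖x‖ < 1` (interior chart),
the polar chart `polarChart x` if `‖x‖ = 1` (boundary chart at `x`). [folklore] -/
def closedBallAmbChart (x : 𝔻 (n + 1)) : OpenPartialHomeomorph (𝔼 (n + 1)) (𝔼 (n + 1)) :=
  if h : ‖(x : 𝔼 (n + 1))‖ < 1 then
    (Homeomorph.addRight ((2 : ℝ) • closedBallBaseVector n)).toOpenPartialHomeomorph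
  else polarChart (⟨x, mem_sphere_zero_iff_norm.2 (norm_coe_eq_one_of_not_lt h)⟩ : 𝕊 n)

/-- At an interior point the ambient chart is the translation by `2e₀`. [folklore] -/
theorem closedBallAmbChart_of_norm_lt_one {x : 𝔻 (n + 1)} (h : ‖(x : 𝔼 (n + 1))‖ < 1) :
    closedBallAmbChart x =
      (Homeomorph.addRight ((2 : ℝ) • closedBallBaseVector n)).toOpenPartialHomeomorph :=
  dif_pos h

/-- At a boundary point the ambient chart is the polar chart at that point. [folklore] -/
theorem closedBallAmbChart_of_norm_eq_one {x : 𝔻 (n + 1)} (h : ‖(x : 𝔼 (n + 1))‖ = 1) :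
    closedBallAmbChart x = polarChart (⟨x, mem_sphere_zero_iff_norm.2 h⟩ : 𝕊 n) := by
  rw [closedBallAmbChart, dif_neg (by rw [h]; exact lt_irrefl 1)]

/-- The ambient chart at an interior point, pointwise. [folklore] -/
theorem closedBallAmbChart_apply_of_norm_lt_one {x : 𝔻 (n + 1)} (h : ‖(x : 𝔼 (n + 1))‖ < 1)
    (w : 𝔼 (n + 1)) : closedBallAmbChart x w = w + (2 : ℝ) • closedBallBaseVector n := by
  rw [closedBallAmbChart_of_norm_lt_one h]
  rfl

/-- The inverse ambient chart at an interior point, pointwise. [folklore] -/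
theorem closedBallAmbChart_symm_apply_of_norm_lt_one {x : 𝔻 (n + 1)}
    (h : ‖(x : 𝔼 (n + 1))‖ < 1) (z : 𝔼 (n + 1)) :
    (closedBallAmbChart x).symm z = z - (2 : ℝ) • closedBallBaseVector n := by
  rw [closedBallAmbChart_of_norm_lt_one h, Homeomorph.toOpenPartialHomeomorph_symm_apply,
    Homeomorph.addRight_symm, Homeomorph.coe_addRight, sub_eq_add_neg]

/-- **The extended chart at `x` is the restriction of the ambient chart at `x`** (for every
point of `𝔻ⁿ⁺¹`: both charts are given by total formulas). [folklore] -/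
theorem extChartAt_closedBall_apply (x y : 𝔻 (n + 1)) :
    extChartAt (𝓡∂ (n + 1)) x y = closedBallAmbChart x (y : 𝔼 (n + 1)) := by
  by_cases h : ‖(x : 𝔼 (n + 1))‖ < 1
  · rw [closedBallAmbChart_apply_of_norm_lt_one h, extChartAt, closedBall_chartAt_of_norm_lt_one h]
    rfl
  · rw [closedBallAmbChart_of_norm_eq_one (norm_coe_eq_one_of_not_lt h), extChartAt,
      closedBall_chartAt_of_norm_eq_one (norm_coe_eq_one_of_not_lt h)]
    rfl

/-- The point `x` itself lies in the source of the ambient chart at `x`. [folklore] -/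
theorem coe_mem_closedBallAmbChart_source (x : 𝔻 (n + 1)) :
    (x : 𝔼 (n + 1)) ∈ (closedBallAmbChart x).source := by
  by_cases h : ‖(x : 𝔼 (n + 1))‖ < 1
  · rw [closedBallAmbChart_of_norm_lt_one h]
    exact mem_univ _
  · rw [closedBallAmbChart_of_norm_eq_one (norm_coe_eq_one_of_not_lt h)]
    exact mem_polarChart_source_self _

/-- The ambient chart is `C^∞` on its (open) source. [folklore] -/
theorem contDiffOn_closedBallAmbChart (x : 𝔻 (n + 1)) :
    ContDiffOn ℝ ∞ (closedBallAmbChart x) (closedBallAmbChart x).source := by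
  by_cases h : ‖(x : 𝔼 (n + 1))‖ < 1
  · rw [closedBallAmbChart_of_norm_lt_one h]
    exact (contDiff_id.add contDiff_const).contDiffOn
  · rw [closedBallAmbChart_of_norm_eq_one (norm_coe_eq_one_of_not_lt h)]
    exact contDiffOn_polarChart _

/-- The inverse of the ambient chart is `C^∞` on all of `ℝⁿ⁺¹`. [folklore] -/
theorem contDiff_closedBallAmbChart_symm (x : 𝔻 (n + 1)) :
    ContDiff ℝ ∞ (closedBallAmbChart x).symm := by
  by_cases h : ‖(x : 𝔼 (n + 1))‖ < 1
  · have : ((closedBallAmbChart x).symm : 𝔼 (n + 1) → 𝔼 (n + 1)) =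
        fun z => z - (2 : ℝ) • closedBallBaseVector n :=
      funext (closedBallAmbChart_symm_apply_of_norm_lt_one h)
    rw [this]
    exact contDiff_id.sub contDiff_const
  · rw [closedBallAmbChart_of_norm_eq_one (norm_coe_eq_one_of_not_lt h)]
    exact contDiff_polarChart_symm _

/-- The ambient chart is `C^∞` at every point of its source. [folklore] -/
theorem contDiffAt_closedBallAmbChart (x : 𝔻 (n + 1)) {w : 𝔼 (n + 1)}
    (hw : w ∈ (closedBallAmbChart x).source) : ContDiffAt ℝ ∞ (closedBallAmbChart x) w :=
  (contDiffOn_closedBallAmbChart x).contDiffAt ((closedBallAmbChart x).open_source.mem_nhds hw)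

/-- **On the target of the extended chart at `x`, the inverse extended chart is the inverse
ambient chart** (followed by the inclusion). [folklore] -/
theorem coe_extChartAt_closedBall_symm_apply (x : 𝔻 (n + 1)) {e : 𝔼 (n + 1)}
    (he : e ∈ (extChartAt (𝓡∂ (n + 1)) x).target) :
    (((extChartAt (𝓡∂ (n + 1)) x).symm e : 𝔻 (n + 1)) : 𝔼 (n + 1)) =
      (closedBallAmbChart x).symm e := by
  rw [extChartAt_target] at he
  obtain ⟨he1, he2⟩ := he
  have he0 : 0 ≤ e 0 := by
    rw [range_modelWithCornersEuclideanHalfSpace] at he2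
    exact he2
  have hsymm : (𝓡∂ (n + 1)).symm e = ⟨e, he0⟩ :=
    (𝓡∂ (n + 1)).left_inv (x := (⟨e, he0⟩ : EuclideanHalfSpace (n + 1)))
  rw [mem_preimage, hsymm] at he1
  rw [extChartAt_coe_symm, comp_apply, hsymm]
  by_cases h : ‖(x : 𝔼 (n + 1))‖ < 1
  · rw [closedBall_chartAt_of_norm_lt_one h] at he1 ⊢
    rw [closedBallAmbChart_symm_apply_of_norm_lt_one h]
    exact coe_closedBallInteriorChart_symm_apply (le_of_lt he1)
  · have h1 := norm_coe_eq_one_of_not_lt h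
    rw [closedBall_chartAt_of_norm_eq_one h1] at he1 ⊢
    rw [closedBallAmbChart_of_norm_eq_one h1]
    exact coe_closedBallBoundaryChart_symm_eq_polarChart_symm _ (le_of_lt he1)

/-- The target of the extended chart at `x` lies in the target of the ambient chart. [folklore] -/
theorem extChartAt_target_subset_closedBallAmbChart_target (x : 𝔻 (n + 1)) :
    (extChartAt (𝓡∂ (n + 1)) x).target ⊆ (closedBallAmbChart x).target := by
  intro e he
  rw [extChartAt_target] at he
  obtain ⟨he1, he2⟩ := he
  have he0 : 0 ≤ e 0 := by
    rw [range_modelWithCornersEuclideanHalfSpace] at he2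
    exact he2
  have hsymm : (𝓡∂ (n + 1)).symm e = ⟨e, he0⟩ :=
    (𝓡∂ (n + 1)).left_inv (x := (⟨e, he0⟩ : EuclideanHalfSpace (n + 1)))
  rw [mem_preimage, hsymm] at he1
  by_cases h : ‖(x : 𝔼 (n + 1))‖ < 1
  · rw [closedBallAmbChart_of_norm_lt_one h]
    exact mem_univ _
  · have h1 := norm_coe_eq_one_of_not_lt h
    rw [closedBall_chartAt_of_norm_eq_one h1] at he1
    rw [closedBallAmbChart_of_norm_eq_one h1]
    exact he1

/-- The chart point `extChartAt x x` is the image of `x` under the ambient chart. [folklore] -/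
theorem extChartAt_closedBall_self (x : 𝔻 (n + 1)) :
    extChartAt (𝓡∂ (n + 1)) x x = closedBallAmbChart x (x : 𝔼 (n + 1)) :=
  extChartAt_closedBall_apply x x

/-- The inverse ambient chart sends the chart point back to `x`. [folklore] -/
theorem closedBallAmbChart_symm_extChartAt_self (x : 𝔻 (n + 1)) :
    (closedBallAmbChart x).symm (extChartAt (𝓡∂ (n + 1)) x x) = (x : 𝔼 (n + 1)) := by
  rw [extChartAt_closedBall_self, (closedBallAmbChart x).left_inv (coe_mem_closedBallAmbChart_source x)]

/-! ### The differential of the ambient chart and of its inverse -/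

/-- The ambient chart has a derivative at every point of its source. [folklore] -/
theorem hasFDerivAt_closedBallAmbChart (x : 𝔻 (n + 1)) {w : 𝔼 (n + 1)}
    (hw : w ∈ (closedBallAmbChart x).source) :
    HasFDerivAt (closedBallAmbChart x) (fderiv ℝ (closedBallAmbChart x) w) w :=
  ((contDiffAt_closedBallAmbChart x hw).differentiableAt (by simp)).hasFDerivAt

/-- The inverse ambient chart has a derivative everywhere. [folklore] -/
theorem hasFDerivAt_closedBallAmbChart_symm (x : 𝔻 (n + 1)) (e : 𝔼 (n + 1)) :
    HasFDerivAt (closedBallAmbChart x).symm (fderiv ℝ (closedBallAmbChart x).symm e) e :=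
  (((contDiff_closedBallAmbChart_symm x).differentiable (by simp)) e).hasFDerivAt

/-- `D(ambChart⁻¹)(ambChart w) ∘ D(ambChart)(w) = id` on the source. [folklore] -/
theorem fderiv_closedBallAmbChart_symm_comp (x : 𝔻 (n + 1)) {w : 𝔼 (n + 1)}
    (hw : w ∈ (closedBallAmbChart x).source) :
    (fderiv ℝ (closedBallAmbChart x).symm (closedBallAmbChart x w)).comp
      (fderiv ℝ (closedBallAmbChart x) w) = ContinuousLinearMap.id ℝ (𝔼 (n + 1)) := by
  have hc := (hasFDerivAt_closedBallAmbChart_symm x (closedBallAmbChart x w)).comp w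
    (hasFDerivAt_closedBallAmbChart x hw)
  have heq : ((closedBallAmbChart x).symm ∘ closedBallAmbChart x) =ᶠ[𝓝 w] id :=
    (closedBallAmbChart x).eventually_left_inverse hw
  exact (hc.congr_of_eventuallyEq heq.symm).unique (hasFDerivAt_id w)

/-- `D(ambChart)(ambChart⁻¹ e) ∘ D(ambChart⁻¹)(e) = id` on the target. [folklore] -/
theorem fderiv_closedBallAmbChart_comp_symm (x : 𝔻 (n + 1)) {e : 𝔼 (n + 1)}
    (he : e ∈ (closedBallAmbChart x).target) :
    (fderiv ℝ (closedBallAmbChart x) ((closedBallAmbChart x).symm e)).comp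
      (fderiv ℝ (closedBallAmbChart x).symm e) = ContinuousLinearMap.id ℝ (𝔼 (n + 1)) := by
  have hc := (hasFDerivAt_closedBallAmbChart x ((closedBallAmbChart x).map_target he)).comp e
    (hasFDerivAt_closedBallAmbChart_symm x e)
  have heq : (closedBallAmbChart x ∘ (closedBallAmbChart x).symm) =ᶠ[𝓝 e] id :=
    (closedBallAmbChart x).eventually_right_inverse he
  exact (hc.congr_of_eventuallyEq heq.symm).unique (hasFDerivAt_id e)

/-! ### The differential of the inclusion `𝔻ⁿ⁺¹ ↪ ℝⁿ⁺¹` as a linear isomorphism -/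

/-- **The differential at `x` of the inclusion `𝔻ⁿ⁺¹ ↪ ℝⁿ⁺¹`, as a linear isomorphism from the
tangent space `T_x𝔻ⁿ⁺¹ = ℝⁿ⁺¹` (read in the preferred chart at `x`) onto the ambient `ℝⁿ⁺¹`**:
the derivative of the inverse ambient chart at the chart point `extChartAt x x`, with inverse
the derivative of the ambient chart at `x` (`mfderiv_coe_closedBall` identifies it with
`mfderiv (𝓡∂ (n+1)) 𝓘(ℝ, ℝⁿ⁺¹) Subtype.val x`). [folklore] -/
def closedBallCoeDeriv (x : 𝔻 (n + 1)) : 𝔼 (n + 1) ≃L[ℝ] 𝔼 (n + 1) :=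
  ContinuousLinearEquiv.equivOfInverse
    (fderiv ℝ (closedBallAmbChart x).symm (extChartAt (𝓡∂ (n + 1)) x x))
    (fderiv ℝ (closedBallAmbChart x) (x : 𝔼 (n + 1)))
    (fun v => by
      have h := fderiv_closedBallAmbChart_comp_symm x
        (extChartAt_target_subset_closedBallAmbChart_target x (mem_extChartAt_target x))
      rw [closedBallAmbChart_symm_extChartAt_self] at h
      simpa using congrArg (fun L : 𝔼 (n + 1) →L[ℝ] 𝔼 (n + 1) => L v) h)
    (fun v => by
      have h := fderiv_closedBallAmbChart_symm_comp x (coe_mem_closedBallAmbChart_source x)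
      rw [← extChartAt_closedBall_self] at h
      simpa using congrArg (fun L : 𝔼 (n + 1) →L[ℝ] 𝔼 (n + 1) => L v) h)

/-- As a linear map, `closedBallCoeDeriv x` is the derivative of the inverse ambient chart at
the chart point. [folklore] -/
theorem coe_closedBallCoeDeriv (x : 𝔻 (n + 1)) :
    (closedBallCoeDeriv x : 𝔼 (n + 1) →L[ℝ] 𝔼 (n + 1)) =
      fderiv ℝ (closedBallAmbChart x).symm (extChartAt (𝓡∂ (n + 1)) x x) :=
  rfl

/-- The inverse of `closedBallCoeDeriv x` is the derivative of the ambient chart at `x`.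
[folklore] -/
theorem coe_closedBallCoeDeriv_symm (x : 𝔻 (n + 1)) :
    ((closedBallCoeDeriv x).symm : 𝔼 (n + 1) →L[ℝ] 𝔼 (n + 1)) =
      fderiv ℝ (closedBallAmbChart x) (x : 𝔼 (n + 1)) :=
  rfl

/-- Pointwise unfolding of `closedBallCoeDeriv`. [folklore] -/
theorem closedBallCoeDeriv_apply (x : 𝔻 (n + 1)) (v : 𝔼 (n + 1)) :
    closedBallCoeDeriv x v = fderiv ℝ (closedBallAmbChart x).symm (extChartAt (𝓡∂ (n + 1)) x x) v :=
  rfl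

/-- The inverse ambient chart has derivative `closedBallCoeDeriv x` at the chart point. [folklore] -/
theorem hasFDerivAt_closedBallAmbChart_symm_extChartAt (x : 𝔻 (n + 1)) :
    HasFDerivAt (closedBallAmbChart x).symm (closedBallCoeDeriv x : 𝔼 (n + 1) →L[ℝ] 𝔼 (n + 1))
      (extChartAt (𝓡∂ (n + 1)) x x) :=
  hasFDerivAt_closedBallAmbChart_symm x _

/-- At an interior point the differential of the inclusion is the identity (the interior chart
is a translation). [folklore] -/
theorem closedBallCoeDeriv_of_norm_lt_one {x : 𝔻 (n + 1)} (h : ‖(x : 𝔼 (n + 1))‖ < 1) :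
    (closedBallCoeDeriv x : 𝔼 (n + 1) →L[ℝ] 𝔼 (n + 1)) = ContinuousLinearMap.id ℝ (𝔼 (n + 1)) := by
  rw [coe_closedBallCoeDeriv]
  have : ((closedBallAmbChart x).symm : 𝔼 (n + 1) → 𝔼 (n + 1)) =
      fun z => z - (2 : ℝ) • closedBallBaseVector n :=
    funext (closedBallAmbChart_symm_apply_of_norm_lt_one h)
  rw [this, fderiv_sub_const, fderiv_fun_id]

/-! ### The differential of the inclusion is `closedBallCoeDeriv` -/

/-- In the extended chart at `x`, the inclusion `𝔻ⁿ⁺¹ ↪ ℝⁿ⁺¹` reads as the inverse ambient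
chart near the chart point (within the half-space). [folklore] -/
theorem writtenInExtChartAt_coe_closedBall_eventuallyEq (x : 𝔻 (n + 1)) :
    writtenInExtChartAt (𝓡∂ (n + 1)) 𝓘(ℝ, 𝔼 (n + 1)) x (Subtype.val : (𝔻 (n + 1)) → 𝔼 (n + 1))
      =ᶠ[𝓝[range (𝓡∂ (n + 1))] (extChartAt (𝓡∂ (n + 1)) x x)] (closedBallAmbChart x).symm := by
  filter_upwards [extChartAt_target_mem_nhdsWithin x] with e he
  simp only [writtenInExtChartAt, extChartAt_model_space_eq_id, PartialEquiv.refl_coe, comp_apply,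
    id_eq]
  exact coe_extChartAt_closedBall_symm_apply x he

/-- **The differential of the inclusion `𝔻ⁿ⁺¹ ↪ ℝⁿ⁺¹` at `x` is `closedBallCoeDeriv x`.**
[folklore] -/
theorem hasMFDerivAt_coe_closedBall (x : 𝔻 (n + 1)) :
    HasMFDerivAt (𝓡∂ (n + 1)) 𝓘(ℝ, 𝔼 (n + 1)) (Subtype.val : (𝔻 (n + 1)) → 𝔼 (n + 1)) x
      (closedBallCoeDeriv x : 𝔼 (n + 1) →L[ℝ] 𝔼 (n + 1)) := by
  refine ⟨continuous_subtype_val.continuousAt, ?_⟩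
  have hpt : writtenInExtChartAt (𝓡∂ (n + 1)) 𝓘(ℝ, 𝔼 (n + 1)) x
      (Subtype.val : (𝔻 (n + 1)) → 𝔼 (n + 1)) (extChartAt (𝓡∂ (n + 1)) x x) =
      (closedBallAmbChart x).symm (extChartAt (𝓡∂ (n + 1)) x x) := by
    simp only [writtenInExtChartAt, extChartAt_model_space_eq_id, PartialEquiv.refl_coe,
      comp_apply, id_eq]
    exact coe_extChartAt_closedBall_symm_apply x (mem_extChartAt_target x)
  exact (hasFDerivAt_closedBallAmbChart_symm_extChartAt x).hasFDerivWithinAt.congr_of_eventuallyEq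
    (writtenInExtChartAt_coe_closedBall_eventuallyEq x) hpt

/-- **`mfderiv` of the inclusion `𝔻ⁿ⁺¹ ↪ ℝⁿ⁺¹` is `closedBallCoeDeriv`.** [folklore] -/
theorem mfderiv_coe_closedBall (x : 𝔻 (n + 1)) :
    mfderiv (𝓡∂ (n + 1)) 𝓘(ℝ, 𝔼 (n + 1)) (Subtype.val : (𝔻 (n + 1)) → 𝔼 (n + 1)) x =
      (closedBallCoeDeriv x : 𝔼 (n + 1) →L[ℝ] 𝔼 (n + 1)) :=
  (hasMFDerivAt_coe_closedBall x).mfderiv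

/-- The differential of a composite `g ∘ Subtype.val` (an ambient `C¹` map restricted to the
ball): `mfderiv (g|𝔻) x = Dg(x) ∘ closedBallCoeDeriv x`. [folklore] -/
theorem mfderiv_comp_coe_closedBall {F : Type*} [NormedAddCommGroup F] [NormedSpace ℝ F]
    {g : 𝔼 (n + 1) → F} (x : 𝔻 (n + 1)) (hg : DifferentiableAt ℝ g (x : 𝔼 (n + 1))) :
    mfderiv (𝓡∂ (n + 1)) 𝓘(ℝ, F) (fun y : 𝔻 (n + 1) => g y) x =
      (fderiv ℝ g (x : 𝔼 (n + 1))).comp (closedBallCoeDeriv x : 𝔼 (n + 1) →L[ℝ] 𝔼 (n + 1)) := by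
  have h := (hg.hasFDerivAt.hasMFDerivAt).comp x (hasMFDerivAt_coe_closedBall x)
  exact h.mfderiv

/-- **The differential of the inverse extended chart, read ambiently**: for `e` in the chart
target, composing the manifold derivative of `(extChartAt x)⁻¹` (within the half-space) with the
differential of the inclusion at the image point gives the derivative of the inverse ambient
chart at `e`. [folklore] -/
theorem closedBallCoeDeriv_comp_mfderivWithin_extChartAt_symm (x : 𝔻 (n + 1)) {e : 𝔼 (n + 1)}
    (he : e ∈ (extChartAt (𝓡∂ (n + 1)) x).target) :
    (closedBallCoeDeriv ((extChartAt (𝓡∂ (n + 1)) x).symm e) : 𝔼 (n + 1) →L[ℝ] 𝔼 (n + 1)).comp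
        (mfderivWithin 𝓘(ℝ, 𝔼 (n + 1)) (𝓡∂ (n + 1)) (extChartAt (𝓡∂ (n + 1)) x).symm
          (range (𝓡∂ (n + 1))) e) =
      fderiv ℝ (closedBallAmbChart x).symm e := by
  have h1 := (mdifferentiableWithinAt_extChartAt_symm he).hasMFDerivWithinAt
  have h2 := hasMFDerivAt_coe_closedBall ((extChartAt (𝓡∂ (n + 1)) x).symm e)
  have h3 : HasFDerivWithinAt (Subtype.val ∘ (extChartAt (𝓡∂ (n + 1)) x).symm)
      ((closedBallCoeDeriv ((extChartAt (𝓡∂ (n + 1)) x).symm e) : 𝔼 (n + 1) →L[ℝ] 𝔼 (n + 1)).comp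
        (mfderivWithin 𝓘(ℝ, 𝔼 (n + 1)) (𝓡∂ (n + 1)) (extChartAt (𝓡∂ (n + 1)) x).symm
          (range (𝓡∂ (n + 1))) e)) (range (𝓡∂ (n + 1))) e :=
    hasMFDerivWithinAt_iff_hasFDerivWithinAt.1 (h2.comp_hasMFDerivWithinAt e h1)
  have h4 : HasFDerivWithinAt (closedBallAmbChart x).symm (fderiv ℝ (closedBallAmbChart x).symm e)
      (range (𝓡∂ (n + 1))) e := (hasFDerivAt_closedBallAmbChart_symm x e).hasFDerivWithinAt
  have heq : (Subtype.val ∘ (extChartAt (𝓡∂ (n + 1)) x).symm) =ᶠ[𝓝[range (𝓡∂ (n + 1))] e]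
      (closedBallAmbChart x).symm := by
    filter_upwards [extChartAt_target_mem_nhdsWithin_of_mem he] with e' he'
    exact coe_extChartAt_closedBall_symm_apply x he'
  have h4' := h4.congr_of_eventuallyEq heq (coe_extChartAt_closedBall_symm_apply x he)
  exact ((𝓡∂ (n + 1)).uniqueDiffOn _ (extChartAt_target_subset_range x he)).eq h3 h4'

/-! ### Pull-back of ambient vector fields -/

/-- **Pull-back of an ambient vector field along the inclusion**: Mathlib's
`VectorField.mpullback` of `V : ℝⁿ⁺¹ → ℝⁿ⁺¹` along `𝔻ⁿ⁺¹ ↪ ℝⁿ⁺¹` is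
`x ↦ (closedBallCoeDeriv x)⁻¹ (V x)`. [folklore] -/
theorem mpullback_coe_closedBall (V : (w : 𝔼 (n + 1)) → TangentSpace 𝓘(ℝ, 𝔼 (n + 1)) w)
    (x : 𝔻 (n + 1)) :
    VectorField.mpullback (𝓡∂ (n + 1)) 𝓘(ℝ, 𝔼 (n + 1))
        (Subtype.val : (𝔻 (n + 1)) → 𝔼 (n + 1)) V x =
      (closedBallCoeDeriv x).symm (V (x : 𝔼 (n + 1))) := by
  rw [VectorField.mpullback_apply, mfderiv_coe_closedBall]
  change (closedBallCoeDeriv x : 𝔼 (n + 1) →L[ℝ] 𝔼 (n + 1)).inverse (V x) = _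
  rw [ContinuousLinearMap.inverse_equiv]
  rfl

/-! ### Smooth vector fields on the ball are the smooth ambient vector fields -/

/-- **The trivialisation of `T𝔻ⁿ⁺¹` at `x₀` in ambient terms**: for `x` with `↑x` in the
source of the ambient chart at `x₀` (a neighbourhood of `x₀`), the tangent vector `v ∈ T_x𝔻ⁿ⁺¹`
reads `D(ambChart x₀)(x) (closedBallCoeDeriv x v)` in the trivialisation at `x₀` (chain rule for
`extChartAt x₀ ∘ (extChartAt x)⁻¹ = ambChart x₀ ∘ (ambChart x)⁻¹`). [folklore] -/
theorem trivializationAt_tangentSpace_closedBall_snd {x₀ x : 𝔻 (n + 1)}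
    (hx : (x : 𝔼 (n + 1)) ∈ (closedBallAmbChart x₀).source) (v : 𝔼 (n + 1)) :
    (trivializationAt (𝔼 (n + 1)) (TangentSpace (𝓡∂ (n + 1))) x₀
        (Bundle.TotalSpace.mk' (𝔼 (n + 1)) x v)).2 =
      fderiv ℝ (closedBallAmbChart x₀) (x : 𝔼 (n + 1)) (closedBallCoeDeriv x v) := by
  rw [TangentBundle.trivializationAt_apply]
  change fderivWithin ℝ (extChartAt (𝓡∂ (n + 1)) x₀ ∘ (extChartAt (𝓡∂ (n + 1)) x).symm)
    (range (𝓡∂ (n + 1))) (extChartAt (𝓡∂ (n + 1)) x x) v = _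
  have hpt0 : (closedBallAmbChart x).symm (extChartAt (𝓡∂ (n + 1)) x x) = (x : 𝔼 (n + 1)) :=
    closedBallAmbChart_symm_extChartAt_self x
  have hd : HasFDerivAt (closedBallAmbChart x₀ ∘ (closedBallAmbChart x).symm)
      ((fderiv ℝ (closedBallAmbChart x₀) (x : 𝔼 (n + 1))).comp
        (closedBallCoeDeriv x : 𝔼 (n + 1) →L[ℝ] 𝔼 (n + 1))) (extChartAt (𝓡∂ (n + 1)) x x) := by
    refine HasFDerivAt.comp _ ?_ (hasFDerivAt_closedBallAmbChart_symm_extChartAt x)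
    rw [hpt0]
    exact hasFDerivAt_closedBallAmbChart x₀ hx
  have heq : (extChartAt (𝓡∂ (n + 1)) x₀ ∘ (extChartAt (𝓡∂ (n + 1)) x).symm)
      =ᶠ[𝓝[range (𝓡∂ (n + 1))] (extChartAt (𝓡∂ (n + 1)) x x)]
      (closedBallAmbChart x₀ ∘ (closedBallAmbChart x).symm) := by
    filter_upwards [extChartAt_target_mem_nhdsWithin x] with e he
    rw [comp_apply, comp_apply, extChartAt_closedBall_apply, coe_extChartAt_closedBall_symm_apply x he]
  have hpt : (extChartAt (𝓡∂ (n + 1)) x₀ ∘ (extChartAt (𝓡∂ (n + 1)) x).symm)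
      (extChartAt (𝓡∂ (n + 1)) x x) =
      (closedBallAmbChart x₀ ∘ (closedBallAmbChart x).symm) (extChartAt (𝓡∂ (n + 1)) x x) := by
    rw [comp_apply, comp_apply, extChartAt_closedBall_apply,
      coe_extChartAt_closedBall_symm_apply x (mem_extChartAt_target x)]
  rw [(hd.hasFDerivWithinAt.congr_of_eventuallyEq heq hpt).fderivWithin
    ((𝓡∂ (n + 1)).uniqueDiffOn _ (mem_range_self _))]
  rfl

/-- The family `x ↦ D(ambChart x₀)(x)` is `C^∞` near `x₀` (as a map from the ball to
matrices). [folklore] -/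
theorem contMDiffAt_fderiv_closedBallAmbChart (x₀ : 𝔻 (n + 1)) :
    ContMDiffAt (𝓡∂ (n + 1)) 𝓘(ℝ, 𝔼 (n + 1) →L[ℝ] 𝔼 (n + 1)) ∞
      (fun x : 𝔻 (n + 1) => fderiv ℝ (closedBallAmbChart x₀) (x : 𝔼 (n + 1))) x₀ := by
  have h1 : ContDiffOn ℝ ∞ (fderiv ℝ (closedBallAmbChart x₀)) (closedBallAmbChart x₀).source :=
    (contDiffOn_closedBallAmbChart x₀).fderiv_of_isOpen (closedBallAmbChart x₀).open_source le_rfl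
  have h2 : ContDiffAt ℝ ∞ (fderiv ℝ (closedBallAmbChart x₀)) (x₀ : 𝔼 (n + 1)) :=
    h1.contDiffAt ((closedBallAmbChart x₀).open_source.mem_nhds (coe_mem_closedBallAmbChart_source x₀))
  exact h2.contMDiffAt.comp x₀ (contMDiff_coe_closedBall x₀)

/-- The family `x ↦ D(ambChart x₀⁻¹)(ambChart x₀ x)` of inverse matrices is `C^∞` near `x₀`.
[folklore] -/
theorem contMDiffAt_fderiv_closedBallAmbChart_symm (x₀ : 𝔻 (n + 1)) :
    ContMDiffAt (𝓡∂ (n + 1)) 𝓘(ℝ, 𝔼 (n + 1) →L[ℝ] 𝔼 (n + 1)) ∞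
      (fun x : 𝔻 (n + 1) => fderiv ℝ (closedBallAmbChart x₀).symm
        (closedBallAmbChart x₀ (x : 𝔼 (n + 1)))) x₀ := by
  have h1 : ContDiff ℝ ∞ (fderiv ℝ (closedBallAmbChart x₀).symm) :=
    (contDiff_closedBallAmbChart_symm x₀).fderiv_right le_rfl
  have h2 : ContMDiffAt (𝓡∂ (n + 1)) 𝓘(ℝ, 𝔼 (n + 1)) ∞
      (fun x : 𝔻 (n + 1) => closedBallAmbChart x₀ (x : 𝔼 (n + 1))) x₀ :=
    (contDiffAt_closedBallAmbChart x₀ (coe_mem_closedBallAmbChart_source x₀)).contMDiffAt.comp x₀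
      (contMDiff_coe_closedBall x₀)
  exact h1.contDiffAt.contMDiffAt.comp x₀ h2

/-- **Smoothness of vector fields on `𝔻ⁿ⁺¹` is ambient smoothness (pointwise).**  A section
`X` of `T𝔻ⁿ⁺¹` is `C^∞` at `x₀` iff its ambient representative
`x ↦ closedBallCoeDeriv x (X x) : 𝔻ⁿ⁺¹ → ℝⁿ⁺¹` is `C^∞` at `x₀`. [folklore] -/
theorem contMDiffAt_tangentSection_iff_closedBall
    {X : (x : 𝔻 (n + 1)) → TangentSpace (𝓡∂ (n + 1)) x} {x₀ : 𝔻 (n + 1)} :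
    ContMDiffAt (𝓡∂ (n + 1)) (𝓡∂ (n + 1)).tangent ∞
        (fun x => (Bundle.TotalSpace.mk' (𝔼 (n + 1)) x (X x) : TangentBundle (𝓡∂ (n + 1)) (𝔻 (n + 1)))) x₀ ↔
      ContMDiffAt (𝓡∂ (n + 1)) 𝓘(ℝ, 𝔼 (n + 1)) ∞
        (fun x => closedBallCoeDeriv x (X x)) x₀ := by
  rw [ModelWithCorners.tangent, Bundle.contMDiffAt_section]
  -- near `x₀` the trivialised section is `C x (g x)` with `C x = D(ambChart x₀)(x)`
  have hnhds : ∀ᶠ x : 𝔻 (n + 1) in 𝓝 x₀, (x : 𝔼 (n + 1)) ∈ (closedBallAmbChart x₀).source :=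
    continuous_subtype_val.continuousAt.preimage_mem_nhds
      ((closedBallAmbChart x₀).open_source.mem_nhds (coe_mem_closedBallAmbChart_source x₀))
  have heq : (fun x => (trivializationAt (𝔼 (n + 1)) (TangentSpace (𝓡∂ (n + 1))) x₀
      (Bundle.TotalSpace.mk' (𝔼 (n + 1)) x (X x))).2) =ᶠ[𝓝 x₀]
      fun x => fderiv ℝ (closedBallAmbChart x₀) (x : 𝔼 (n + 1)) (closedBallCoeDeriv x (X x)) := by
    filter_upwards [hnhds] with x hx
    exact trivializationAt_tangentSpace_closedBall_snd hx (X x)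
  constructor
  · intro h
    have h1 := h.congr_of_eventuallyEq heq.symm
    have h2 := (contMDiffAt_fderiv_closedBallAmbChart_symm x₀).clm_apply h1
    refine h2.congr_of_eventuallyEq ?_
    filter_upwards [hnhds] with x hx
    have hid := fderiv_closedBallAmbChart_symm_comp x₀ hx
    have := congrArg (fun L : 𝔼 (n + 1) →L[ℝ] 𝔼 (n + 1) => L (closedBallCoeDeriv x (X x))) hid
    simpa using this.symm
  · intro h
    exact ((contMDiffAt_fderiv_closedBallAmbChart x₀).clm_apply h).congr_of_eventuallyEq heq

/-- **Smoothness of vector fields on `𝔻ⁿ⁺¹` is ambient smoothness (global).** [folklore] -/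
theorem contMDiff_tangentSection_iff_closedBall
    {X : (x : 𝔻 (n + 1)) → TangentSpace (𝓡∂ (n + 1)) x} :
    ContMDiff (𝓡∂ (n + 1)) (𝓡∂ (n + 1)).tangent ∞
        (fun x => (Bundle.TotalSpace.mk' (𝔼 (n + 1)) x (X x) : TangentBundle (𝓡∂ (n + 1)) (𝔻 (n + 1)))) ↔
      ContMDiff (𝓡∂ (n + 1)) 𝓘(ℝ, 𝔼 (n + 1)) ∞ fun x => closedBallCoeDeriv x (X x) :=
  ⟨fun h x => contMDiffAt_tangentSection_iff_closedBall.1 (h x),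
    fun h x => contMDiffAt_tangentSection_iff_closedBall.2 (h x)⟩

end Literature.Topology.FourManifolds

end
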